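import Mathlib
import Summits.AnomalousDissipation.AnomalousDissipation.Theses.PointSink
import Literature.Analysis.FluidPDE.StationaryEulerPotentials
import Literature.Analysis.FunctionSpaces.SobolevDomain

/-!
# Sketch — crux-ideate round 1, ideator 1, crux `PointFluxCone` (stmt-AnomalousDissipation-19033)

First lemmas of the two idea cards (statements only; they must elaborate, not be proved):

* Card A `dilation-periodised-wild-blob`: the transfer `BlobFlux → PointFluxCone`.
* Card B `pressureless-cone-bernoulli-momentum`: the packet-pressure identity for trace-free
  (pressureless) wave certificates of the tree's Choffrut–Székelyhidi potentials.
-/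

noncomputable section

open MeasureTheory
open scoped InnerProductSpace RealInnerProductSpace

namespace Summit.AnomalousDissipation.AnomalousDissipation.Cruxes.PointFluxCone.Sketch

local notation "E³" => EuclideanSpace ℝ (Fin 3)

/-! ## Card A — the blob transfer -/

/-- `BlobFlux` (the transferred crux C⁺): a bounded, compactly supported weak stationary Euler
pair `(W, P)` on the WHOLE space `ℝ³` (all smooth compactly supported vector tests, explicit
pressure; weakly divergence free) whose Bernoulli momentum `J = ∫ (½|W|² + P) W dx` is non-zero.
For smooth (or any Bernoulli-renormalisable) flows `J = 0`; `J` is the first moment of the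
Duchon–Robert defect distribution. -/
def BlobFlux : Prop :=
  ∃ (W : E³ → E³) (P : E³ → ℝ) (R M : ℝ),
    AEStronglyMeasurable W volume ∧ AEStronglyMeasurable P volume ∧
    (∀ x, ‖W x‖ ≤ M ∧ |P x| ≤ M) ∧
    (∀ x, R ≤ ‖x‖ → W x = 0 ∧ P x = 0) ∧
    (∀ φ : E³ → E³, Literature.Analysis.FunctionSpaces.IsTestFunctionOn ⊤ φ →
      ∫ x, (inner ℝ (W x) (fderiv ℝ φ x (W x)) +
        P x * Literature.Analysis.FluidPDE.VectorCalculus.divergence φ x) = 0) ∧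
    (∀ θ : E³ → ℝ, Literature.Analysis.FunctionSpaces.IsTestFunctionOn ⊤ θ →
      ∫ x, inner ℝ (W x) (gradient θ x) = 0) ∧
    (∫ x, (‖W x‖ ^ 2 / 2 + P x) • W x) ≠ 0

/-- The dilation-periodised velocity built from one blob `W` translated to centre `c`:
`V(x) = Σ_{k ∈ ℤ} λ^{-2k/3} W(λ^{-k} x - c)` (locally at most one non-zero term when the dilated
supports are disjoint). -/
def periodisedVelocity (lam : ℝ) (W : E³ → E³) (c : E³) (x : E³) : E³ :=
  ∑' k : ℤ, (lam ^ (-(2 / 3 : ℝ) * (k : ℝ))) • W ((lam ^ (-(k : ℝ))) • x - c)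

/-- The dilation-periodised pressure `P(x) = Σ_k λ^{-4k/3} P_W(λ^{-k} x - c)`. -/
def periodisedPressure (lam : ℝ) (P : E³ → ℝ) (c : E³) (x : E³) : ℝ :=
  ∑' k : ℤ, (lam ^ (-(4 / 3 : ℝ) * (k : ℝ))) * P ((lam ^ (-(k : ℝ))) • x - c)

/-- Exact discrete self-similarity of the periodised field (pure reindexing `k ↦ k - 1`). -/
def PeriodisedIsDSS : Prop :=
  ∀ (lam : ℝ) (W : E³ → E³) (c : E³), 1 < lam →
    ∀ x : E³, x ≠ 0 →
      periodisedVelocity lam W c (lam • x) = lam ^ (-(2 / 3 : ℝ)) • periodisedVelocity lam W c x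

/-- **First lemma of Card A (the transfer).** One wild blob with `J ≠ 0`, translated far out along
`J` and dilation-periodised, witnesses the crux: the shell log-mean flux equals
`∫ (½|W|²+P) W · (y+c)/|y+c|² dy = J·c/|c|² + O(|c|⁻²) ≠ 0`. -/
def BlobTransfer : Prop :=
  BlobFlux → Summit.AnomalousDissipation.AnomalousDissipation.Theses.PointSink.PointFluxCone

/-! ## Card B — pressureless certificates have lower-order packet pressure -/

open Literature.Analysis.FluidPDE Literature.Analysis.FluidPDE.StationaryEuler

/-- **First lemma of Card B (trace identity).** For a trace-free wave certificate (`tr S̄ = 0`,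
i.e. the Choffrut–Székelyhidi `d ≥ 3` admissible directions `(a,a⊗a)-(b,b⊗b)`, `q̄ = 0`), the
trace of the stress potential is `tr S[φ] = (S̄ : ∇²φ)/|η|²` for EVERY potential `φ`
(from `Σ_i Φ_{ikil} = (tr S̄ η_k η_l + S̄_{kl}|η|²)/|η|⁴` and `S̄η = 0`). Hence the packet pressure
`p = tr S / d` carries no `H''` and no `H'` term. -/
def PressurelessTrace : Prop :=
  ∀ (c : WaveCert (Fin 3)), c.S.trace = 0 →
    ∀ (φ : Ed (Fin 3) → ℝ) (x : Ed (Fin 3)),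
      ∑ m, c.strS φ m m x =
        (∑ k, ∑ l, c.S k l * pd (eb k) (pd (eb l) φ) x) / ‖c.η‖ ^ 2

/-- **Corollary (modulated plane waves).** For `φ = χ · G(η·x)` the `G'`, `G''` terms drop out:
`tr S[χ G(η·)] (x) = (S̄ : ∇²χ)(x) G(η·x)/|η|²`; with `G = H(N·)/N²` the packet pressure is
`O(‖S̄‖ ‖χ‖_{C²} ‖H‖_∞ / N²)`, summable along a frequency-escalated iteration. -/
def PressurelessPacketPressure : Prop :=
  ∀ (c : WaveCert (Fin 3)), c.S.trace = 0 →
    ∀ (χ : Ed (Fin 3) → ℝ) (G : ℝ → ℝ), ContDiff ℝ (⊤ : ℕ∞) χ → ContDiff ℝ (⊤ : ℕ∞) G →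
      ∀ x : Ed (Fin 3),
        ∑ m, c.strS (fun y => χ y * G (⟪c.η, y⟫_ℝ)) m m x =
          (∑ k, ∑ l, c.S k l * pd (eb k) (pd (eb l) χ) x) * G (⟪c.η, x⟫_ℝ) / ‖c.η‖ ^ 2

/-- **Bernoulli function is prescribed** (pointwise algebra behind Card B): if `|v|² = e` and
`p = q - e/3` then `½|v|² + p = e/6 + q`; so `J = (1/6)∫ e v + ∫ q v`. -/
theorem bernoulli_prescribed (v : E³) (e p q : ℝ) (hv : ‖v‖ ^ 2 = e) (hp : p = q - e / 3) :
    ‖v‖ ^ 2 / 2 + p = e / 6 + q := by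
  subst hp; rw [hv]; ring


/-! ## Barrier note F1 — renormalised-Bernoulli rigidity (statement for the disprover; NOT a card) -/

/-- **Renormalised-Bernoulli rigidity (F1).** A DSS degree `(-2/3, -4/3)` pair `(V, P)` off the origin whose
Bernoulli function `B = ½|V|² + P` admits INDICATOR RENORMALISATION — the super-level fields `1_{B>c} V` and
sub-level fields `1_{B<-c} V` are weakly divergence free off the origin for every `c > 0` — and whose radial
energy-flux density is integrable on the fundamental shell, has ZERO log-mean flux. (Layer-cake + the scaling
`Ψ_c = λ^{4/3} Ψ_{λ^{4/3} c}` + Chebyshev; no boundedness, no moments. Renormalisation holds for profiles that are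
`C¹` off thin conical sets with `∫_{Z_ε ∩ shell} |V| = o(ε)`, across bounded conical sheets, and for `C^γ` bulk,
`γ > 1/2`; so every witness of `PointFluxCone` is bulk non-renormalisable.) -/
def RenormalisedBernoulliRigidity : Prop :=
  ∀ (lam : ℝ) (V : E³ → E³) (P : E³ → ℝ), 1 < lam →
    AEStronglyMeasurable V volume → AEStronglyMeasurable P volume →
    (∀ x : E³, x ≠ 0 → V (lam • x) = lam ^ (-(2 / 3 : ℝ)) • V x) →
    (∀ x : E³, x ≠ 0 → P (lam • x) = lam ^ (-(4 / 3 : ℝ)) * P x) →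
    LocallyIntegrableOn (fun x => ‖V x‖ ^ 2) {x : E³ | x ≠ 0} volume →
    LocallyIntegrableOn P {x : E³ | x ≠ 0} volume →
    (∀ c : ℝ, 0 < c →
      (∀ θ : E³ → ℝ, Literature.Analysis.FunctionSpaces.IsTestFunctionOn ⟨{x : E³ | x ≠ 0}, isOpen_ne⟩ θ →
        ∫ x, ({x : E³ | c < ‖V x‖ ^ 2 / 2 + P x}.indicator (fun x => inner ℝ (V x) (gradient θ x))) x = 0) ∧
      (∀ θ : E³ → ℝ, Literature.Analysis.FunctionSpaces.IsTestFunctionOn ⟨{x : E³ | x ≠ 0}, isOpen_ne⟩ θ →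
        ∫ x, ({x : E³ | ‖V x‖ ^ 2 / 2 + P x < -c}.indicator (fun x => inner ℝ (V x) (gradient θ x))) x = 0)) →
    IntegrableOn (fun x => (‖V x‖ ^ 2 / 2 + P x) * (inner ℝ (V x) x / ‖x‖ ^ 2))
      {x : E³ | 1 < ‖x‖ ∧ ‖x‖ < lam} volume →
    (∫ x in {x : E³ | 1 < ‖x‖ ∧ ‖x‖ < lam}, (‖V x‖ ^ 2 / 2 + P x) * (inner ℝ (V x) x / ‖x‖ ^ 2)) = 0

end Summit.AnomalousDissipation.AnomalousDissipation.Cruxes.PointFluxCone.Sketch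

end
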